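import Summits.BirchSwinnertonDyer.BirchSwinnertonDyer.Theorems.CMKolyvaginAtInertTwoTauPartDescentAtTwoPow
import Summits.BirchSwinnertonDyer.BirchSwinnertonDyer.Theorems.CMKolyvaginAtInertTwoKolyvaginPrimeInertAtTwo
import Summits.BirchSwinnertonDyer.BirchSwinnertonDyer.Theorems.CMKolyvaginAtInertTwoCMExactDescentAtTwo
import HarnessLib

/-!
# Route `CMKolyvaginAtInertTwo`, crux `CMKolyvaginExactAtInertTwo` (stmt-BirchSwinnertonDyer-24277):
# the level-`2^M` descents at `2` IN THE ROUTE'S CURRENCY — CM-inert-supported data (route rev 8),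
# level `N_E`, and the items' `M₀`-clause over `E(K[1])`

Seat `bsd-line-cmk2-p1` g7 (cell `bsd-print-cf2`); helper (`--supports stmt-BirchSwinnertonDyer-24277`).
THEOREMS ONLY: no definition, no named fact, no `sorry`; no item is closed; BSD is not proved by this.

The `(−ε)`-part (p618706) and `τ`-part (p620411) descents at level `2^M` take the machine's two inputs
with FULL support and a Heegner point `P ∈ E(K)` with `2^a P ∉ 2^M E(K)`. The route's items speak of
CM-INERT-supported Kolyvagin primes (`IsKolyvaginPrime … 2 ℓ ∧ CMInert W ℓ`, rev 8), of
`y_K = d₁.derivedPoint ∈ E(K[1])` and of its `2`-divisibility there (`M₀`). This file closes the gap: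

* `two_pow_smul_ne_of_not_divisible_ringClassField` — the `M₀`-CLAUSE CONVERSION: for `P₀ ∈ E(K)`
  mapping to `y ∈ E(K[1])` with `¬ ∃ Q ∈ E(K[1]), 2^{M₀+1} Q = y`, and `M ≥ M₀ + 1`:
  `2^M Q ≠ 2^{M−1−M₀} P₀` for every `Q ∈ E(K)` (uses `E(K[1])[2^∞] = 0` on the habitat, g0's
  `CMExactDescent.eq_zero_of_two_pow_smul_eq_zero_ringClassField`, and the injectivity of
  `E(K) → E(K[1])`) — i.e. the hypothesis `hy` of the descents with `a = M − 1 − M₀`.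
* `two_pow_smul_selmer_minus_eq_zero_of_cmInert_families_two_pow` — the `(−ε)`-part ON H₂ with
  CM-INERT-supported data at level `N_E`: every Gross-form Kolyvagin prime of depth `M` is of depth `1`,
  hence CM-inert on H₂ (g6's `cmInert_of_isKolyvaginPrime_two`, p609668), so the route's data suffice.
* `two_pow_smul_sub_conjAct_eq_zero_of_cmInert_families_two_pow` — the `τ`-part likewise.

What stays a hypothesis: the Cartan-type `z` (`hcomm`, CM theory on `E[2^∞]`) and ty2's data at `2`.
References: [GrossLMS1991] §4 (4.1), Props. 2.1, 5.3; [McCallumLMS1991] §5 Lemma 5.1; [Darmon2004] Thm. 3.7.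
-/

-- single-conjunct summit: `Summit.BirchSwinnertonDyer.BirchSwinnertonDyer.…` repeats the name by design
set_option linter.dupNamespace false
set_option autoImplicit false

noncomputable section

open scoped Classical
open WeierstrassCurve NumberField IsDedekindDomain Field
open Literature.NumberTheory.GaloisRepresentations Literature.NumberTheory.EllipticCurves
open Literature.NumberTheory.EllipticCurves.Rank1Residual

namespace Summit.BirchSwinnertonDyer.BirchSwinnertonDyer.Theorems.KolyvaginDescentTwo

variable (W : WeierstrassCurve ℚ) {K : Type} [Field K] [NumberField K]

/-- **The `M₀`-clause conversion.** On the habitat (`ρ̄_{W,2}` onto, `K` imaginary quadratic with odd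
`d_K` and the Heegner hypothesis for `N_E`, so that `E(K[1])[2^∞] = 0`): if `P₀ ∈ E(K)` maps to
`y ∈ E(K[1])` and `y ∉ 2^{M₀+1} E(K[1])`, then for `M ≥ M₀ + 1` and every `Q ∈ E(K)`,
`2^M Q ≠ 2^{M−1−M₀} P₀` (else `R = 2^{M₀+1}Q − P₀` is `2^{M−1−M₀}`-torsion, hence `0`).
[cite: GrossLMS1991, §4 (4.1)] [cite: McCallumLMS1991, §5 Lemma 5.1] -/
theorem two_pow_smul_ne_of_not_divisible_ringClassField [W.IsElliptic] [W.IsGloballyMinimal]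
    (hK : IsImaginaryQuadratic K) (hodd : Odd (NumberField.discr K))
    (hH : SatisfiesHeegnerHypothesis (W.conductorNorm ℤ) K) (hρ : W.HasSurjectiveModNGaloisRep 2)
    (ι : K →+* ℂ) {P₀ : (W.baseChange K).toAffine.Point}
    {y : (W.baseChange (ringClassField K ι 1)).toAffine.Point}
    (hP₀ : WeierstrassCurve.Affine.Point.map (W' := W) (algebraMap K (ringClassField K ι 1)).toRatAlgHom P₀ = y)
    {M₀ M : ℕ} (hM : M₀ + 1 ≤ M)
    (hndiv : ¬ ∃ Q : (W.baseChange (ringClassField K ι 1)).toAffine.Point, ((2 ^ (M₀ + 1) : ℕ) : ℤ) • Q = y) :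
    ∀ Q : (W.baseChange K).toAffine.Point, ((2 ^ M : ℕ) : ℤ) • Q ≠ ((((2 : ℕ) : ℤ) ^ (M - 1 - M₀))) • P₀ := by
  intro Q hQ
  set f : (W.baseChange K).toAffine.Point →+ (W.baseChange (ringClassField K ι 1)).toAffine.Point :=
    WeierstrassCurve.Affine.Point.map (W' := W) (algebraMap K (ringClassField K ι 1)).toRatAlgHom with hf
  apply hndiv
  refine ⟨f Q, ?_⟩
  -- `R = 2^{M₀+1} f Q − y` is killed by `2^{M-1-M₀}`, hence `0`
  have hR : ((2 ^ (M - 1 - M₀) : ℕ) : ℤ) • ((((2 ^ (M₀ + 1) : ℕ) : ℤ)) • f Q - y) = 0 := by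
    rw [zsmul_sub, smul_smul, ← Nat.cast_mul, ← pow_add, show M - 1 - M₀ + (M₀ + 1) = M by omega,
      ← map_zsmul, hQ, map_zsmul, hP₀, Nat.cast_pow, sub_self]
  have h0 := CMExactDescent.eq_zero_of_two_pow_smul_eq_zero_ringClassField W hK hodd hH hρ ι (M - 1 - M₀) _ hR
  exact (sub_eq_zero.mp h0)

/-- **The `(−ε)`-part descent at level `2^M` ON H₂ WITH THE ROUTE'S CM-INERT-SUPPORTED DATA** (level
`N_E`): `W` globally minimal with CM, `CMInert W 2`, `ρ̄_{W,2}` onto; `K` imaginary quadratic with the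
Heegner hypothesis for `N_E` and conjugation `c ≠ 1`; `P ∈ E(K)` a Heegner point of level `N_E`;
`M ≥ 1`, `a < M` with `2^M Q ≠ 2^a P` for all `Q`; `ν = ±1` with `cP − νP` not torsion; the Cartan-type
`z` (`hcomm`); ty2's DATA `PointSystemFamily N_E W K P 2 (CMInert W)`, `ReciprocityFamily N_E W K 2
(CMInert W)`. Then `2^{M−a}·s = 0` for every `s ∈ Sel_{2^M}(E/K)` with `c_* s = ν s`.
[cite: GrossLMS1991, Prop. 2.1 with §10 (proof), (4.4), Props. 5.3, 6.2]
[cite: McCallumLMS1991, §2 Prop. 2.2, §3 Cor. 3.2, §5 Lemmas 5.1, 5.3] -/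
theorem two_pow_smul_selmer_minus_eq_zero_of_cmInert_families_two_pow [W.IsElliptic]
    [W.IsGloballyMinimal] [NeZero (W.conductorNorm ℤ)] (hCM : W.HasCM) (hin : CMInert W 2)
    (hρ : W.HasSurjectiveModNGaloisRep 2) (hK : IsImaginaryQuadratic K)
    (hH : SatisfiesHeegnerHypothesis (W.conductorNorm ℤ) K)
    {P : (W.baseChange K).toAffine.Point} (hP : IsHeegnerPoint (W.conductorNorm ℤ) W K P)
    {c : K ≃ₐ[ℚ] K} (hc : c ≠ 1) {M : ℕ} (hM : 1 ≤ M) {z : absoluteGaloisGroup K}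
    (hzfix : ∀ T : geomTorsion (W.baseChange K) ((2 : ℕ) : ℤ), z • T = T → T = 0)
    (hcomm : ∀ π ∈ torsionFixing (W.baseChange K) ((2 : ℕ) : ℤ),
      ∀ T : geomTorsion (W.baseChange K) ((2 ^ M : ℕ) : ℤ), π • z • T = z • π • T)
    {a : ℕ} (ha : a < M)
    (hy : ∀ Q : (W.baseChange K).toAffine.Point, ((2 ^ M : ℕ) : ℤ) • Q ≠ ((((2 : ℕ) : ℤ) ^ a)) • P)
    {ν : ℤ} (hν : ν = 1 ∨ ν = -1)
    (hPν : ¬ IsOfFinAddOrder (Affine.Point.map (W' := W) (c : K →ₐ[ℚ] K) P - ν • P))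
    (D : Rank1Residual.P2.KolyvaginMachine.PointSystemFamily (W.conductorNorm ℤ) W K P 2 (CMInert W))
    (R : Rank1Residual.P2.KolyvaginMachine.ReciprocityFamily (W.conductorNorm ℤ) W K 2 (CMInert W)) :
    ∀ s ∈ selmerGroup (W.baseChange K) ((2 ^ M : ℕ) : ℤ), conjAct W c ((2 ^ M : ℕ) : ℤ) s = ν • s →
      (((2 : ℕ) : ℤ) ^ (M - a)) • s = 0 := by
  have hΔ : W.Δ < 0 := KolyvaginEigenTwo.Δ_neg_of_cmInert_two W hCM hin hρ
  have hΔK : ¬ IsSquare (W.baseChange K).Δ := by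
    have h : (W.baseChange K).Δ = algebraMap ℚ K W.Δ := by rw [baseChange, map_Δ]
    rw [h]
    exact KolyvaginImageTwo.not_isSquare_algebraMap_Δ_of_cmInert_two_of_heegner W hCM hin hρ K hK hH
  refine two_pow_smul_selmer_minus_eq_zero_two_pow W hK hP hρ hΔ hΔK hc hM (q := 2 ^ M) rfl hzfix
    hcomm ha hy hν hPν ?_ ?_
  · intro hdiv
    obtain ⟨ε, τ, hτ, A, hA, Pt, hPt, hε, h53, hAτ, hPt1, hm'⟩ :=
      Rank1Residual.P2.KolyvaginMachine.hpoints_of_pointSystemFamily D hM hdiv c hc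
    exact ⟨ε, τ, hτ, A, hA, Pt, hPt, hε, h53, hAτ, hPt1, fun m hm hq ↦
      hm' m hm fun q hq' ↦ ⟨(hq q hq').1, (hq q hq').2,
        cmInert_of_isKolyvaginPrime_two W hCM hin hρ (hq q hq').1⟩⟩
  · intro ℓ hℓ hF
    exact Rank1Residual.P2.KolyvaginMachine.hRT_of_reciprocityFamily R hM hℓ hF
      (cmInert_of_isKolyvaginPrime_two W hCM hin hρ hℓ)

/-- **The `τ`-part descent at level `2^M` ON H₂ WITH THE ROUTE'S CM-INERT-SUPPORTED DATA**: with the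
hypotheses of `two_pow_smul_selmer_minus_eq_zero_of_cmInert_families_two_pow` (`P` of infinite order,
`ε = ±1` the sign with `cP − εP` torsion): `2^{M−a}·(s − ε c_* s) = 0` for every `s ∈ Sel_{2^M}(E/K)`.
[cite: GrossLMS1991, Prop. 2.1 with §10 (proof), §5 (5.2)] [cite: McCallumLMS1991, §5 Lemma 5.1] -/
theorem two_pow_smul_sub_conjAct_eq_zero_of_cmInert_families_two_pow [W.IsElliptic]
    [W.IsGloballyMinimal] [NeZero (W.conductorNorm ℤ)] (hCM : W.HasCM) (hin : CMInert W 2)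
    (hρ : W.HasSurjectiveModNGaloisRep 2) (hK : IsImaginaryQuadratic K)
    (hH : SatisfiesHeegnerHypothesis (W.conductorNorm ℤ) K)
    {P : (W.baseChange K).toAffine.Point} (hP : IsHeegnerPoint (W.conductorNorm ℤ) W K P)
    (hnt : ¬ IsOfFinAddOrder P) {c : K ≃ₐ[ℚ] K} (hc : c ≠ 1) {M : ℕ} (hM : 1 ≤ M)
    {z : absoluteGaloisGroup K}
    (hzfix : ∀ T : geomTorsion (W.baseChange K) ((2 : ℕ) : ℤ), z • T = T → T = 0)
    (hcomm : ∀ π ∈ torsionFixing (W.baseChange K) ((2 : ℕ) : ℤ),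
      ∀ T : geomTorsion (W.baseChange K) ((2 ^ M : ℕ) : ℤ), π • z • T = z • π • T)
    {a : ℕ} (ha : a < M)
    (hy : ∀ Q : (W.baseChange K).toAffine.Point, ((2 ^ M : ℕ) : ℤ) • Q ≠ ((((2 : ℕ) : ℤ) ^ a)) • P)
    {ε : ℤ} (hε : ε = 1 ∨ ε = -1)
    (hPε : IsOfFinAddOrder (Affine.Point.map (W' := W) (c : K →ₐ[ℚ] K) P - ε • P))
    (D : Rank1Residual.P2.KolyvaginMachine.PointSystemFamily (W.conductorNorm ℤ) W K P 2 (CMInert W))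
    (R : Rank1Residual.P2.KolyvaginMachine.ReciprocityFamily (W.conductorNorm ℤ) W K 2 (CMInert W)) :
    ∀ s ∈ selmerGroup (W.baseChange K) ((2 ^ M : ℕ) : ℤ),
      (((2 : ℕ) : ℤ) ^ (M - a)) • (s - ε • conjAct W c ((2 ^ M : ℕ) : ℤ) s) = 0 := by
  haveI : Algebra.IsQuadraticExtension ℚ K := ⟨hK.1⟩
  haveI : IsTotallyComplex K := hK.2
  intro s hs
  have hν : (-ε) = 1 ∨ (-ε) = -1 := by rcases hε with rfl | rfl <;> simp
  have hPν := not_isOfFinAddOrder_map_sub_neg_smul W hnt c hε hPε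
  have hcard : Nat.card (K ≃ₐ[ℚ] K) = 2 := by rw [IsGalois.card_aut_eq_finrank, hK.1]
  have hcc : c * c = 1 := by
    have h := pow_card_eq_one' (G := K ≃ₐ[ℚ] K) (x := c)
    rwa [hcard, pow_two] at h
  have hεε : ε * ε = 1 := by rcases hε with rfl | rfl <;> norm_num
  set t := s - ε • conjAct W c ((2 ^ M : ℕ) : ℤ) s with ht
  have htS : t ∈ selmerGroup (W.baseChange K) ((2 ^ M : ℕ) : ℤ) :=
    sub_mem hs (AddSubgroup.zsmul_mem _
      (conjAct_mem_selmerGroup W (fun w ↦ IsTotallyComplex.isComplex w) c _ hs) ε)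
  have htν : conjAct W c ((2 ^ M : ℕ) : ℤ) t = (-ε) • t := by
    rw [ht, map_sub, map_zsmul, conjAct_conjAct_of_mul_self W hcc, zsmul_sub, smul_smul, neg_mul, hεε,
      neg_one_zsmul, neg_zsmul]
    abel
  exact two_pow_smul_selmer_minus_eq_zero_of_cmInert_families_two_pow W hCM hin hρ hK hH hP hc hM hzfix
    hcomm ha hy hν hPν D R t htS htν

end Summit.BirchSwinnertonDyer.BirchSwinnertonDyer.Theorems.KolyvaginDescentTwo

end
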